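import Mathlib
import Summits.ResolutionOfSingularities.ResolutionOfSingularities.Theorems.WeightedInvariantLocalWeightedDropMonicDescentLabels
import Summits.ResolutionOfSingularities.ResolutionOfSingularities.Theorems.WeightedInvariantLocalWeightedDropMonicDescentBlowOneLaws

/-!
# `WeightedInvariant.LocalWeightedDrop`, line `hasse-ridge-face-selection`, S3ρ sub-stub S3ρD `stub_wildMonicSurfaceDescent`:
# the `d!`-SCALED NEWTON SET of a monic tuple and the COORDINATE-FLAG numbers `(d_F, s_F)` (Perlega's case `n_F = 0`) — definitions

Crux item stmt-ResolutionOfSingularities-8899 `LocalWeightedDrop` (route `ResolutionOfSingularities/WeightedInvariant`), engine of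
the door `HypersurfaceCentreConstruction` stmt-ResolutionOfSingularities-19897.  [OURS · L1 W4.3, chain w43, res-L1-w43-stub-7 (second
seat on S3ρ under res-type-083, CHAIN v4.3 SEAT TABLE v6 row stub-7; case D-a of `L/res-type-083/S3RHO-DESIGN.md` §1(D)).  Objects
the engine line posits for the MEASURE of the general monic surface game; MODEL: S. Perlega, *A new proof for the embedded resolution
of surface singularities* (thesis Wien 2017 / arXiv:2011.14443) Ch. 7 §7.2 = Hauser–Perlega, Publ. RIMS 60 (2024) §8 pp. 802–803, the
flag invariant in the case `n_𝓕 = 0`, specialised to the game's positions (`I₃ = (f)`, `c = d`, no old components).  Nothing here is a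
statement of H. Hironaka's manuscript [claim: Hironaka2017, status: under-review]; nothing is asserted about Perlega's text either —
these are OUR definitions, read on the coefficient tuple in the strategy's own coordinates.]

A POSITION of the S3ρ game is a tuple `A = (A_j)_{j<d}`, `A_j ∈ k[[x₁,x₂]]`, standing for the monic form `y^d + Σ_j A_j y^j`
(`WildMonic.monic_won_of_descent`).  Everything below is read in the GIVEN coordinates `(x₁, x₂)` = letters `(0, 1)` and for the
COORDINATE FLAG `F₂ = V(y) ⊃ F₁ = V(y, x₂)` (the `x₁`-axis), which has `n_F = 0` for every boundary `E ⊆ {V(x₁), V(x₂)}`.  All numbers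
live on the `d!`-SCALE (Perlega's `c!`-scale with `c = d`), so that they are natural numbers:

* `slotWeight d j = d!/(d − j)` and `newtonSet A ⊂ ℕ²` — the points `(d!/(d−j))·e` over the exponents `e` of `A_j`: the generating
  points of Hironaka's polyhedron `Δ(y^d + Σ A_j y^j; x; y)` scaled by `d!`, equivalently the exponents of the generators
  `A_j^{d!/(d−j)}` of the coefficient ideal `J₂ = coeff^d(f)` (HP p. 802 «coeff^k(J) = (f_i^{k!/(k−i)} : i < k)»).  For `d = 2` this is
  `MonicDescent.newtonSet A₀ A₁` of the N4″ files (same scale `2 = 2!`); the point-set invariants `MonicDescent.deltaL/alphaL/epsL` and the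
  chart map `MonicDescent.psi` are IMPORTED from there and used at scale `d!`.
* `excExp E N = r = (r₁, r₂)` — the exponents of the exceptional monomial `M₂ = x₁^{r₁} x₂^{r₂}`: `r_i = ord_{x_i} J₂` if `V(x_i)` is a
  boundary component, else `0` (HP p. 802 «`J₂ = M₂ · I₂`, `M₂ = (x^{r_x} y^{r_y})`, `r_x, r_y` maximal with `V(M₂) ⊆ E_a`»).
* `reduce r N = N − r` — the points of the RESIDUAL FACTOR `I₂ = J₂ / M₂`.
* `dRes E N = deltaL (N − r)` — Perlega's `d_F = ord I₂` for the coordinate flag (= Hauser–Perlega's residual order `d_res` of §4 on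
  the `d!`-scale; `= deltaL N − r₁ − r₂`, `WildMonic.dRes_add_excExp`).
* `coeffOrd δ S` — the ORDER OF THE COEFFICIENT IDEAL `coeff^δ` with respect to `x₂` of a point set `S ⊂ ℕ²` read as exponents
  `x₁^{P₀} x₂^{P₁}`: `⨅ {(δ!/(δ − P₁)) · P₀ : P ∈ S, P₁ < δ}` in `ℕ∞` (`⊤` when no point lies below the row `P₁ = δ`).
* `sFlag E N = coeffOrd (dRes E N) (N − r)` — Perlega's `s_F = ord J₁`, `J₁ = coeff^{d_F}_{(x,y)}(I₂)` (the case `d_F ≥ d!`);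
  `compSet`, `sComp L E N` — the COMPANION reading `J₁ = coeff^{d_F(L − d_F)}(M₂^{d_F} + I₂^{L − d_F})` of the case `0 < d_F < L = d!`
  (HP p. 803), with the power `I₂^{L−d_F}` read through the DILATION `(L − d_F)·(N − r)` of its Newton points; `sValue L E N` — the
  three-way case split of HP p. 803 (`⊤` for `d_F = 0`: `J₁ = 0`).
WHY GENERATOR POINTS GIVE PERLEGA'S IDEAL-LEVEL NUMBERS (remark, not used by the kernel): `ord`, `ord_{x_i}` and every weighted order
are valuations of `k[[x₁,x₂]]`, `coeff^c((f)) ⊆` the integral closure of `(f_i^{c!/(c−i)})_i` (multinomial expansion of `(uf)_i^{c!/(c−i)}`),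
and `ord coeff^δ_y(I) = δ! · sup {λ : I ⊆ {ord_{(1,λ)} ≥ λδ}}` is determined by valuation ideals, hence by the Newton polyhedron of
generators; likewise `supp(A^N)` and `N·supp(A)` span the same polyhedron (the ring is a domain).  So `dRes`/`sFlag`/`sComp` ARE the
printed `d_F`/`s_F` of the coordinate flag for the game's positions; the strategy reads them in its own coordinates, so no
coordinate-independence statement (Perlega Ch. 4) is owed.
The TRANSPORT LAWS under the monomial point step (Perlega Prop. 9.1.1, `n_F = 0`; HP Prop. 4 (i)) are in the sibling file
`…WildMonicFlagN0Transport`; the bridge from the game's literal successor tuple to `psi d! '' newtonSet A` in `…WildMonicNewtonPointStep`.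
-/

set_option linter.dupNamespace false -- mandated namespace of this single-conjunct summit

noncomputable section

namespace Summit.ResolutionOfSingularities.ResolutionOfSingularities.Theorems

namespace WildMonic

open MvPowerSeries MonicDescent

variable {k : Type} [Field k]

/-! ## The scaled Newton set of a tuple -/

/-- The SLOT WEIGHT `d!/(d − j)` of the coefficient `A_j` of `y^d + Σ_{j<d} A_j y^j` (the exponent `c!/(c−i)` of HP p. 802). -/
def slotWeight (d j : ℕ) : ℕ := d.factorial / (d - j)

/-- The `d!`-SCALED NEWTON SET of a tuple `A = (A_j)_{j<d}`: the points `(d!/(d−j)) · e` over the exponents `e` of `A_j`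
(generating points of Hironaka's `Δ(y^d + Σ A_j y^j; x₁,x₂; y)`, times `d!`). -/
def newtonSet {d : ℕ} (A : Fin d → MvPowerSeries (Fin 2) k) : Set (Fin 2 →₀ ℕ) :=
  {P | ∃ (j : Fin d) (e : Fin 2 →₀ ℕ), coeff e (A j) ≠ 0 ∧ P = slotWeight d j • e}

/-! ## The coordinate-flag numbers on a point set `N ⊂ ℕ²` with boundary letters `E ⊆ {0, 1}` -/

/-- The EXCEPTIONAL EXPONENTS `r = (r₁, r₂)` of a point set `N` for the boundary `E`: `r_i =` the least `i`-th coordinate over `N` if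
the letter `i` is a boundary component, else `0` (the monomial `M₂ = x₁^{r₁} x₂^{r₂}` of HP p. 802). -/
def excExp (E : Finset (Fin 2)) (N : Set (Fin 2 →₀ ℕ)) : Fin 2 →₀ ℕ :=
  Finsupp.single 0 (if (0 : Fin 2) ∈ E then alphaL N else 0) +
    Finsupp.single 1 (if (1 : Fin 2) ∈ E then epsL N else 0)

/-- The REDUCED point set `N − r` (pointwise truncated subtraction): the Newton points of the residual factor `I₂ = J₂/M₂`. -/
def reduce (r : Fin 2 →₀ ℕ) (N : Set (Fin 2 →₀ ℕ)) : Set (Fin 2 →₀ ℕ) := (fun P => P - r) '' N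

/-- `d_F` OF THE COORDINATE FLAG (Perlega's `ord I₂`; Hauser–Perlega's residual order `d_res` on the `d!`-scale): the least total
degree of the reduced point set. -/
def dRes (E : Finset (Fin 2)) (N : Set (Fin 2 →₀ ℕ)) : ℕ := deltaL (reduce (excExp E N) N)

/-- The ORDER OF THE COEFFICIENT IDEAL `coeff^δ` WITH RESPECT TO `x₂` of a point set `S` (points = exponents of `x₁^{P₀} x₂^{P₁}`):
`⨅ {(δ!/(δ − P₁)) · P₀ : P ∈ S, P₁ < δ} ∈ ℕ∞` — `⊤` iff no point of `S` lies strictly below the row `P₁ = δ`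
(HP p. 783 «coeff_c(H) = (H_i^{c!/(c−i)}, i < c)», read on exponents). -/
def coeffOrd (δ : ℕ) (S : Set (Fin 2 →₀ ℕ)) : ℕ∞ :=
  ⨅ P ∈ {P : Fin 2 →₀ ℕ | P ∈ S ∧ P 1 < δ}, ((δ.factorial / (δ - P 1) * P 0 : ℕ) : ℕ∞)

/-- `s_F` OF THE COORDINATE FLAG in the case `d_F ≥ d!`: the order of `J₁ = coeff^{d_F}_{x₂}(I₂)` (HP p. 803 first case), read on
the reduced point set. -/
def sFlag (E : Finset (Fin 2)) (N : Set (Fin 2 →₀ ℕ)) : ℕ∞ := coeffOrd (dRes E N) (reduce (excExp E N) N)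

/-- The Newton points of the COMPANION IDEAL `M₂^δ + I₂^{L − δ}` (`δ = deltaL S` the order of the residual factor with points `S`,
`r` the exceptional exponents, `L` the scale): the point `δ · r` of the monomial `M₂^δ` together with the dilation `(L − δ) · S`
(same Newton polyhedron as the power `I₂^{L−δ}`). -/
def compSet (L : ℕ) (r : Fin 2 →₀ ℕ) (S : Set (Fin 2 →₀ ℕ)) : Set (Fin 2 →₀ ℕ) :=
  insert (deltaL S • r) ((fun P => (L - deltaL S) • P) '' S)

/-- `s_F` OF THE COORDINATE FLAG in the COMPANION case `0 < d_F < L` (`L = d!`): the order of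
`J₁ = coeff^{d_F (L − d_F)}_{x₂}(M₂^{d_F} + I₂^{L − d_F})` (HP p. 803 second case), read on `compSet`. -/
def sComp (L : ℕ) (E : Finset (Fin 2)) (N : Set (Fin 2 →₀ ℕ)) : ℕ∞ :=
  coeffOrd (dRes E N * (L - dRes E N)) (compSet L (excExp E N) (reduce (excExp E N) N))

/-- THE `s`-ENTRY of the coordinate flag at scale `L` (`= d!`), HP p. 803's three-way split: `sFlag` if `d_F ≥ L`, `sComp` if
`0 < d_F < L`, and `⊤` if `d_F = 0` (`J₁ = 0`; this is the monomial case, terminal). -/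
def sValue (L : ℕ) (E : Finset (Fin 2)) (N : Set (Fin 2 →₀ ℕ)) : ℕ∞ :=
  if L ≤ dRes E N then sFlag E N else if 0 < dRes E N then sComp L E N else ⊤

/-- THE BOUNDARY AFTER THE MONOMIAL POINT STEP in the `x₁`-chart (successor point = origin of the chart): the new exceptional curve
is `V(s) = V(x₁')` (letter `0`), the old component `V(x₂)` survives (its strict transform passes through the origin of the chart),
the old component `V(x₁)` does not (HP p. 779 «`E′_{a′} = V(xy)` if `t = 0` and `V(y) ⊆ E_a`, `V(x)` … if `V(y) ⊄ E_a`»). -/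
def excNext (E : Finset (Fin 2)) : Finset (Fin 2) := insert 0 (E.filter (· = 1))

/-! ## Unfoldings -/

/-- Membership in the scaled Newton set. -/
theorem mem_newtonSet_iff {d : ℕ} (A : Fin d → MvPowerSeries (Fin 2) k) (P : Fin 2 →₀ ℕ) :
    P ∈ newtonSet A ↔ ∃ (j : Fin d) (e : Fin 2 →₀ ℕ), coeff e (A j) ≠ 0 ∧ P = slotWeight d j • e := Iff.rfl

/-- The slot weight times the complementary degree is `d!`. -/
theorem slotWeight_mul_sub {d : ℕ} (j : Fin d) : slotWeight d j * (d - j) = d.factorial := by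
  unfold slotWeight
  exact Nat.div_mul_cancel (Nat.dvd_factorial (by omega) (by omega))

/-- The slot weight is positive. -/
theorem slotWeight_pos {d : ℕ} (j : Fin d) : 0 < slotWeight d j := by
  have h := slotWeight_mul_sub j
  rcases Nat.eq_zero_or_pos (slotWeight d j) with h0 | h0
  · rw [h0, zero_mul] at h; exact absurd h.symm (Nat.factorial_pos d).ne'
  · exact h0

/-- Components of `excExp`. -/
@[simp] theorem excExp_apply_zero (E : Finset (Fin 2)) (N : Set (Fin 2 →₀ ℕ)) :
    excExp E N 0 = if (0 : Fin 2) ∈ E then alphaL N else 0 := by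
  simp [excExp]

/-- Components of `excExp`. -/
@[simp] theorem excExp_apply_one (E : Finset (Fin 2)) (N : Set (Fin 2 →₀ ℕ)) :
    excExp E N 1 = if (1 : Fin 2) ∈ E then epsL N else 0 := by
  simp [excExp]

/-- Membership in the reduced set. -/
theorem mem_reduce_iff (r : Fin 2 →₀ ℕ) (N : Set (Fin 2 →₀ ℕ)) (Q : Fin 2 →₀ ℕ) :
    Q ∈ reduce r N ↔ ∃ P ∈ N, P - r = Q := Iff.rfl

/-- `0` is always a boundary letter after the `x₁`-chart step; `1` is one iff it was. -/
theorem mem_excNext_iff (E : Finset (Fin 2)) (i : Fin 2) : i ∈ excNext E ↔ i = 0 ∨ (i ∈ E ∧ i = 1) := by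
  simp [excNext]

/-- Unfolding of `sValue` in the case `d_F ≥ L`. -/
theorem sValue_of_le {L : ℕ} {E : Finset (Fin 2)} {N : Set (Fin 2 →₀ ℕ)} (h : L ≤ dRes E N) :
    sValue L E N = sFlag E N := by
  simp [sValue, h]

/-- Unfolding of `sValue` in the companion case `0 < d_F < L`. -/
theorem sValue_of_lt {L : ℕ} {E : Finset (Fin 2)} {N : Set (Fin 2 →₀ ℕ)} (h : dRes E N < L) (h0 : 0 < dRes E N) :
    sValue L E N = sComp L E N := by
  simp [sValue, not_le.mpr h, h0]

/-- Unfolding of `sValue` in the case `d_F = 0`. -/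
theorem sValue_of_eq_zero {L : ℕ} {E : Finset (Fin 2)} {N : Set (Fin 2 →₀ ℕ)} (hL : 0 < L) (h0 : dRes E N = 0) :
    sValue L E N = ⊤ := by
  simp [sValue, h0, Nat.pos_iff_ne_zero.mp hL]

end WildMonic

end Summit.ResolutionOfSingularities.ResolutionOfSingularities.Theorems

end
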